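import Literature.Analysis.Distribution.TranslationQuasiInvariantFunctionalOn
import HarnessLib

/-!
# Closed form of the iterated line projections: `P_L f = W_L · A_L f`

Topic `Analysis/Distribution`; namespace `Literature.Analysis.Distribution`. For a list `L` of directions
`d = (v, φ, λ)` (`Direction`) which is **biorthogonal** (`φ_d v_e = 0` for `d ≠ e` in `L`), the iterated line
projection `lineProjList L f = P_{d_k} ⋯ P_{d_1} f` of `TranslationQuasiInvariantFunctionalOn` has the closed
form

  `lineProjList L f (x) = W_L(x) · A_L f (x)`,  `W_L(x) = Π_d e^{-iλ_d φ_d(x)} ρ(φ_d x)`,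
  `A_L f = A_{d_k} (⋯ (A_{d_1} f))`, `A_d g (x) = ∫ e^{iλ_d s} g(s v_d + x - (φ_d x) v_d) ds`

(`lineAvg`, `lineAvgList`, `lineWeightList`, `lineProjList_eq_mul_lineAvgList`), because each `A_e` commutes
with multiplication by functions invariant along the `e`-lines (`lineAvg_mul_of_lineInvariant`) and the weights
of `d` are functions of `φ_d`, invariant along the other lines. Consequently a functional with
`D f = D (lineProjList L f)` (the structure theorem `apply_eq_apply_lineProjList_on`) **depends on `f` only
through `A_L f`** (`apply_eq_of_lineAvgList_eq`), and `A_L` itself commutes with line-invariant factors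
(`lineAvgList_mul_of_lineInvariant`) and, for `λ_d = 0`, is unchanged by reparametrising the `d`-lines
(`lineAvg_comp_lineShear`). These are the bookkeeping identities of Hörmander, *ALPDO I*, Thm. 3.1.4'
(`u = 1 ⊗ u₀`: `u(φ)` depends only on `∫ φ(·, x_n) dx_n`) for several directions.

Everything is proved; no named fact is introduced.

## References

* L. Hörmander, *The Analysis of Linear Partial Differential Operators I* (1983/2003), Thm. 3.1.4'
  [HormanderALPDO1].
-/

noncomputable section

open MeasureTheory Set Filter Topology Function
open scoped ContDiff ComplexConjugate

namespace Literature.Analysis.Distribution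

variable {X : Type*} [NormedAddCommGroup X] [NormedSpace ℝ X]

/-! ### 1. The twisted line average `A_d` and line-invariant functions -/

/-- **The twisted line average** `A_d g (x) = ∫ e^{iλ s} g(s v + (x - (φ x) v)) ds`
(`= fibreIntegral v φ (e_λ · g)`). [folklore] -/
def lineAvg (d : Direction X) (g : X → ℂ) : X → ℂ :=
  fibreIntegral d.v d.φ (fun y => twistFn d.φ d.lam y * g y)

/-- `A_d g` as an explicit integral. [folklore] -/
theorem lineAvg_apply (d : Direction X) (g : X → ℂ) (x : X) :
    lineAvg d g x = ∫ s : ℝ, Complex.exp (((d.lam * s : ℝ) : ℂ) * Complex.I) * g (s • d.v + (x - (d.φ x) • d.v)) := by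
  unfold lineAvg fibreIntegral
  simp_rw [twistFn_line d.v d.φ d.hφv d.lam x]

/-- **The line weight** `w_d(x) = e^{-iλ φ(x)} ρ(φ x)` of the direction `d`. [folklore] -/
def lineWeight (d : Direction X) (x : X) : ℂ := twistFn d.φ (-d.lam) x * ((stdBump (d.φ x) : ℝ) : ℂ)

/-- **`P_d f = w_d · A_d f`.** [folklore] -/
theorem lineProj_eq_mul_lineAvg (d : Direction X) (f : X → ℂ) :
    lineProj d.v d.φ d.lam f = fun x => lineWeight d x * lineAvg d f x := by
  funext x
  simp only [lineProj, reinsert, lineWeight, lineAvg, mul_assoc]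

/-- **Invariance along the `d`-lines**: `c (s v + (x - (φ x) v)) = c x` for all `s, x`. [folklore] -/
def IsLineInvariant (d : Direction X) (c : X → ℂ) : Prop := ∀ (x : X) (s : ℝ), c (s • d.v + (x - (d.φ x) • d.v)) = c x

/-- **`A_d (c · g) = c · A_d g` for line-invariant `c`.** [folklore] -/
theorem lineAvg_mul_of_lineInvariant (d : Direction X) {c : X → ℂ} (hc : IsLineInvariant d c) (g : X → ℂ) :
    lineAvg d (fun y => c y * g y) = fun x => c x * lineAvg d g x := by
  funext x
  rw [lineAvg_apply, lineAvg_apply, ← integral_const_mul]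
  refine integral_congr_ae (Eventually.of_forall fun s => ?_)
  simp only [hc x s]
  ring

/-- `A_d g` is line-invariant along `d`. [folklore] -/
theorem isLineInvariant_lineAvg (d : Direction X) (g : X → ℂ) : IsLineInvariant d (lineAvg d g) := fun x s => by
  unfold lineAvg
  rw [fibreIntegral_line d.v d.φ d.hφv]
  unfold fibreIntegral
  have h : d.φ (x - (d.φ x) • d.v) = 0 := by rw [map_sub, map_smul, d.hφv, smul_eq_mul, mul_one, sub_self]
  simp only [h, zero_smul, sub_zero]

/-- Functions of `φ_d` are line-invariant along every `e` with `φ_d v_e = 0`. [folklore] -/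
theorem isLineInvariant_comp_of_apply_eq_zero (d e : Direction X) (h0 : d.φ e.v = 0) (c : ℝ → ℂ) :
    IsLineInvariant e (fun x => c (d.φ x)) := fun x s => by
  simp only [map_add, map_sub, map_smul, h0, smul_eq_mul, mul_zero, zero_add, sub_zero]

/-- The weight `w_d` is line-invariant along every `e` with `φ_d v_e = 0`. [folklore] -/
theorem isLineInvariant_lineWeight (d e : Direction X) (h0 : d.φ e.v = 0) : IsLineInvariant e (lineWeight d) := by
  have h := isLineInvariant_comp_of_apply_eq_zero d e h0
    (fun r => Complex.exp (((-d.lam * r : ℝ) : ℂ) * Complex.I) * ((stdBump r : ℝ) : ℂ))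
  intro x s
  have h1 := h x s
  simp only [lineWeight, twistFn] at h1 ⊢
  exact h1

/-- Products of line-invariant functions are line-invariant. [folklore] -/
theorem IsLineInvariant.mul {d : Direction X} {c c' : X → ℂ} (hc : IsLineInvariant d c) (hc' : IsLineInvariant d c') :
    IsLineInvariant d (fun x => c x * c' x) := fun x s => by
  show c _ * c' _ = c x * c' x
  rw [hc x s, hc' x s]

/-! ### 2. The iterated averages and weights; the closed form -/

/-- **Iterated twisted line averages** `A_{[d_1,…,d_k]} f = A_{d_k} (⋯ (A_{d_1} f))`. [folklore] -/
def lineAvgList : List (Direction X) → (X → ℂ) → (X → ℂ)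
  | [], f => f
  | d :: L, f => lineAvgList L (lineAvg d f)

/-- **The product of the line weights** `W_L = Π_{d ∈ L} w_d`. [folklore] -/
def lineWeightList : List (Direction X) → X → ℂ
  | [], _ => 1
  | d :: L, x => lineWeight d x * lineWeightList L x

/-- **Biorthogonality** of a list of directions: `φ_d v_e = 0` for distinct entries. [folklore] -/
def Biorthogonal (L : List (Direction X)) : Prop := L.Pairwise fun d e => d.φ e.v = 0 ∧ e.φ d.v = 0

/-- Biorthogonality of a cons. [folklore] -/
theorem biorthogonal_cons {d : Direction X} {L : List (Direction X)} :
    Biorthogonal (d :: L) ↔ (∀ e ∈ L, d.φ e.v = 0 ∧ e.φ d.v = 0) ∧ Biorthogonal L :=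
  List.pairwise_cons

/-- **`A_L (c · g) = c · A_L g` for `c` line-invariant along every direction of `L`.** [folklore] -/
theorem lineAvgList_mul_of_lineInvariant : ∀ (L : List (Direction X)) {c : X → ℂ} (_hc : ∀ e ∈ L, IsLineInvariant e c)
    (g : X → ℂ), lineAvgList L (fun y => c y * g y) = fun x => c x * lineAvgList L g x
  | [], _, _, _ => rfl
  | d :: L, c, hc, g => by
    simp only [lineAvgList]
    rw [lineAvg_mul_of_lineInvariant d (hc d List.mem_cons_self) g]
    exact lineAvgList_mul_of_lineInvariant L (fun e he => hc e (List.mem_cons_of_mem _ he)) _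

/-- **The closed form** `P_L f = W_L · A_L f` for biorthogonal `L`. [folklore] -/
theorem lineProjList_eq_mul_lineAvgList : ∀ (L : List (Direction X)) (_hL : Biorthogonal L) (f : X → ℂ),
    lineProjList L f = fun x => lineWeightList L x * lineAvgList L f x
  | [], _, f => by funext x; simp [lineProjList, lineWeightList, lineAvgList]
  | d :: L, hL, f => by
    obtain ⟨hd, hL'⟩ := biorthogonal_cons.1 hL
    simp only [lineProjList, lineAvgList, lineWeightList]
    rw [lineProjList_eq_mul_lineAvgList L hL' (lineProj d.v d.φ d.lam f), lineProj_eq_mul_lineAvg,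
      lineAvgList_mul_of_lineInvariant L (fun e he => isLineInvariant_lineWeight d e (hd e he).1)]
    funext x
    ring

/-- **A functional with `D f = D (P_L f)` depends on `f` only through `A_L f`.** [folklore] -/
theorem apply_eq_of_lineAvgList_eq {D : (X → ℂ) → ℂ} {L : List (Direction X)} (hL : Biorthogonal L)
    {f f' : X → ℂ} (hf : D f = D (lineProjList L f)) (hf' : D f' = D (lineProjList L f'))
    (hA : lineAvgList L f = lineAvgList L f') : D f = D f' := by
  rw [hf, hf', lineProjList_eq_mul_lineAvgList L hL, lineProjList_eq_mul_lineAvgList L hL, hA]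

/-! ### 3. Reparametrising the lines of a direction with `λ = 0` -/

/-- **Line reparametrisation invariance**: if `λ_d = 0` and `S` shifts each `d`-line by an amount depending only
on the line, `S (s v + y) = (s + τ y) v + y` for `y = x - (φ x) v`, then `A_d (g ∘ S) = A_d g`. [folklore] -/
theorem lineAvg_comp_lineShear (d : Direction X) (hlam : d.lam = 0) {S : X → X} {τ : X → ℝ}
    (hS : ∀ (x : X) (s : ℝ), S (s • d.v + (x - (d.φ x) • d.v)) = (s + τ (x - (d.φ x) • d.v)) • d.v + (x - (d.φ x) • d.v))
    (g : X → ℂ) : lineAvg d (g ∘ S) = lineAvg d g := by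
  funext x
  rw [lineAvg_apply, lineAvg_apply]
  simp only [hlam, zero_mul, Complex.ofReal_zero, zero_mul, Complex.exp_zero, one_mul, Function.comp_apply, hS]
  exact integral_add_right_eq_self (μ := volume) (fun s : ℝ => g (s • d.v + (x - (d.φ x) • d.v))) (τ (x - (d.φ x) • d.v))

end Literature.Analysis.Distribution
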